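import Mathlib
import Literature.AlgebraicGeometry.Resolution.QuasiExcellentClosedSubschemes
import Literature.AlgebraicGeometry.Resolution.GeneralLUProofs
import Literature.AlgebraicGeometry.Resolution.J2Blowup
import HarnessLib

/-!
# Blowing ups and Cossart–Piltant stages of quasi-excellent schemes are quasi-excellent

Topic: `Literature/AlgebraicGeometry/Resolution`. The quasi-excellence of the schemes `X(i)`
occurring in Cossart–Piltant's principalization ([CoP1] Prop. 4.2 / CP 2019 Prop. 4.4): the base
`S` is excellent and each `X(i+1) → X(i)` is a blowing up, hence locally of finite type, and
"any localization of a finite type ring over a (quasi-)excellent ring is (quasi-)excellent"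
(Stacks, Tag 07QU, DISCHARGED in this tree as `Stacks07QU_holds`). The J-2 half is
`J2Blowup.lean`; this file adds the full statement, PROVED, using that quasi-excellence is local
on `Spec A` (`isQuasiExcellentRing_of_forall_exists_away`, `QuasiExcellentClosedSubschemes.lean`):

* `isQuasiExcellentRing_sections_of_locallyOfFiniteType` — for `f : X → Y` locally of finite type
  with `X` locally Noetherian and `Y` quasi-excellent, every `Γ(X, V)` (`V` affine) is
  quasi-excellent (`V` is covered by basic opens `D(g)` over affine opens `U` of `Y`, and
  `Γ(X, D(g)) = Γ(X, V)_g` is of finite type over `Γ(Y, U)`);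
* `Scheme.IsQuasiExcellent.of_locallyOfFiniteType`, `IsBlowup.isQuasiExcellent`,
  `IsRegularCentreBlowupSeq.isLocallyNoetherian_and_isQuasiExcellent`,
  `IsRegularCentreBlowupSeq.isQuasiExcellent` — hence schemes locally of finite type over, blowing
  ups of, and Cossart–Piltant stages over (quasi-)excellent locally Noetherian schemes are
  quasi-excellent; consequently (`Temkin2008OfHironaka.lean`, `FiniteNormalizationGRing.lean`)
  their local rings are quasi-excellent G-rings and the one-dimensional local domains among them
  have finite normalization.

## Sources

* The Stacks Project, Tag 07QU (= Lemma 15.53.2). [StacksProject]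
* H. Matsumura, *Commutative Ring Theory* (1986), §32, p. 260. [Matsumura1987]
-/

noncomputable section

open CategoryTheory AlgebraicGeometry TopologicalSpace

namespace Literature.AlgebraicGeometry.Resolution

universe u

/-! ## Quasi-excellent coordinate rings under morphisms locally of finite type -/

/-- **Schemes locally of finite type over a quasi-excellent scheme have quasi-excellent affine
coordinate rings**: if `f : X → Y` is locally of finite type, `X` is locally Noetherian and
`Γ(Y, U)` is quasi-excellent for every affine open `U ⊆ Y`, then `Γ(X, V)` is quasi-excellent for
every affine open `V ⊆ X`. [cite: StacksProject, Tag 07QU] -/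
theorem isQuasiExcellentRing_sections_of_locallyOfFiniteType {X Y : Scheme.{u}} (f : X ⟶ Y)
    [LocallyOfFiniteType f] [IsLocallyNoetherian X]
    (hY : ∀ U : Y.affineOpens, IsQuasiExcellentRing Γ(Y, U)) (V : X.affineOpens) :
    IsQuasiExcellentRing Γ(X, V) := by
  haveI : IsNoetherianRing Γ(X, V) := IsLocallyNoetherian.component_noetherian V
  -- the sections `g` whose basic open lies over an affine open of `Y`
  let s : Set Γ(X, V) := {g | ∃ U : Y.affineOpens, X.basicOpen g ≤ f ⁻¹ᵁ (U : Y.Opens)}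
  have hs : Ideal.span s = ⊤ := by
    rw [← V.2.self_le_iSup_basicOpen_iff]
    intro x hxV
    obtain ⟨U, hU, hxU, -⟩ := exists_isAffineOpen_mem_and_subset (X := Y) (x := f x)
      (U := ⊤) (Opens.mem_top _)
    obtain ⟨g, hgle, hxg⟩ := V.2.exists_basicOpen_le (V := f ⁻¹ᵁ U) ⟨x, hxU⟩ hxV
    exact Opens.mem_iSup.mpr ⟨⟨g, ⟨U, hU⟩, hgle⟩, hxg⟩
  refine isQuasiExcellentRing_of_forall_exists_away Γ(X, V) fun p _ => ?_
  -- a `g ∈ s` outside `p`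
  have hex : ∃ g ∈ s, g ∉ p := by
    by_contra h
    push Not at h
    have hle : Ideal.span s ≤ p := Ideal.span_le.mpr h
    rw [hs, top_le_iff] at hle
    exact Ideal.IsPrime.ne_top ‹_› hle
  obtain ⟨g, ⟨U, hU⟩, hgp⟩ := hex
  haveI : IsLocalization.Away g Γ(X, X.basicOpen g) := V.2.isLocalization_basicOpen g
  refine ⟨g, Γ(X, X.basicOpen g), inferInstance, inferInstance, inferInstance, hgp, ?_⟩
  -- `Γ(X, D(g))` is of finite type over `Γ(Y, U)`
  have hft : (f.appLE U (X.basicOpen g) hU).hom.FiniteType :=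
    HasRingHomProperty.appLE (P := @LocallyOfFiniteType) (f := f) inferInstance U
      ⟨_, V.2.basicOpen g⟩ hU
  letI := (f.appLE U (X.basicOpen g) hU).hom.toAlgebra
  exact Stacks07QU_holds _ _ (hY U) hft

/-- **A scheme locally of finite type over a quasi-excellent scheme is quasi-excellent** (for
`X` locally Noetherian). [cite: StacksProject, Tag 07QU] -/
theorem Scheme.IsQuasiExcellent.of_locallyOfFiniteType {X Y : Scheme.{u}} (f : X ⟶ Y)
    [LocallyOfFiniteType f] [IsLocallyNoetherian X] (hY : Scheme.IsQuasiExcellent Y) :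
    Scheme.IsQuasiExcellent X :=
  fun V => isQuasiExcellentRing_sections_of_locallyOfFiniteType f hY V

/-- **A blowing up of a locally Noetherian quasi-excellent scheme is quasi-excellent** (it is
proper, hence locally of finite type). [cite: StacksProject, Tag 07QU] -/
theorem IsBlowup.isQuasiExcellent {X' X : Scheme.{u}} {π : X' ⟶ X} {C : X.IdealSheafData}
    [IsLocallyNoetherian X] (hπ : IsBlowup π C) (hX : Scheme.IsQuasiExcellent X) :
    Scheme.IsQuasiExcellent X' := by
  haveI : IsProper π := hπ.isProper
  haveI : IsLocallyNoetherian X' := LocallyOfFiniteType.isLocallyNoetherian π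
  exact Scheme.IsQuasiExcellent.of_locallyOfFiniteType π hX

/-- **Every stage of a Cossart–Piltant sequence over a locally Noetherian quasi-excellent scheme
is locally Noetherian and quasi-excellent.** [cite: StacksProject, Tag 07QU] -/
theorem IsRegularCentreBlowupSeq.isLocallyNoetherian_and_isQuasiExcellent :
    ∀ {S' S : Scheme.{u}} {σ : S' ⟶ S} {J : S.IdealSheafData}, IsRegularCentreBlowupSeq σ J →
      IsLocallyNoetherian S → Scheme.IsQuasiExcellent S →
      IsLocallyNoetherian S' ∧ Scheme.IsQuasiExcellent S' := by
  intro S' S σ J h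
  induction h with
  | nil J => exact fun hN hS => ⟨hN, hS⟩
  | cons τ σ J Y hσ hint hreg hY hτ ih =>
    intro hN hS
    obtain ⟨hN', hS'⟩ := ih hN hS
    haveI := hN'
    haveI : IsProper τ := hτ.isProper
    exact ⟨LocallyOfFiniteType.isLocallyNoetherian τ, hτ.isQuasiExcellent hS'⟩

/-- In particular over an excellent locally Noetherian scheme. [cite: StacksProject, Tag 07QU] -/
theorem IsRegularCentreBlowupSeq.isQuasiExcellent {S' S : Scheme.{u}} {σ : S' ⟶ S}
    {J : S.IdealSheafData} (h : IsRegularCentreBlowupSeq σ J) [IsLocallyNoetherian S]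
    (hE : Scheme.IsExcellent S) : Scheme.IsQuasiExcellent S' :=
  (h.isLocallyNoetherian_and_isQuasiExcellent inferInstance hE.isQuasiExcellent).2

end Literature.AlgebraicGeometry.Resolution

end
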